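import Literature.Analysis.FunctionSpaces.TorusLineTrigSums
import Literature.Analysis.FunctionSpaces.IntervalDerivL1Closure
import HarnessLib

/-!
# Spectral `H¹` classes on `T^d` are absolutely continuous on almost every coordinate line (Haar-probability convention)

Analysis/FunctionSpaces support file (everything proved; no definitions, no named facts). **Convention of this file**:
the measure on `ℝ/ℤ` is the Haar PROBABILITY measure (the local instances of `HaarTorusBoundedTrigApprox.lean`,
definitionally those of `Mathlib.Analysis.Fourier.AddCircleMulti` and of the Bose-gas form-domain files
`PeriodicFormDomain.lean`), exactly as in the sister file `TorusLineTrigSums.lean`. The tree's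
`TorusLineAbsContinuity.lean` proves the ACL representation for the GLOBAL `volume` of `FlatTorus` (Banach-valued,
`Torus.exists_lineAC_representative`, `Torus.exists_lineAC_representative_of_tsum_ne_top`, with the norm identity
`‖h‖₂² = 4π² ∑ₙ nₚ²‖ĝ(n)‖²`); the present file is the independent box-truncation route to the complex-valued `L²`
statement over the Haar-probability instance, which is the form consumed verbatim by the Bose-gas hard-core files
(`BoseGasHardCrossingLines`, `BoseGasHardLayerDecay`, `PeriodicMaxFormBoundHardCore`), whose `L²((ℝ/ℤ)^{3N})` lives
over that instance.

The statement (Evans–Gariepy §4.9.2 Thm. 2; Ziemer Thm. 2.1.4, one coordinate, Fourier side): let `g ∈ L²(T^d)`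
(measurable representative) and a coordinate `q` with finite directional spectral energy `∑ₙ n_q² |ĝ(n)|² < ∞`. Then
(`Torus.exists_lineACL_repr`) there are measurable `G = g` a.e. and `H ∈ L²(T^d)` with `Ĥ(n) = 2πi n_q ĝ(n)` (the weak
`∂_q`-derivative) such that for a.e. `t ∈ T^d`, along the whole line `x ↦ t + x𝐞_q` (`x ∈ ℝ`),

  `x ↦ H(t + x𝐞_q)` is locally integrable and `G(t + b𝐞_q) - G(t + a𝐞_q) = ∫_a^b H(t + x𝐞_q) dx` for all `a, b`.

Proof: the box truncations `P_R = ∑_{|nᵢ|≤R} ĝ(n)e_n` and `Q_R = ∑ 2πi n_q ĝ(n) e_n` converge in `L²` to `g` and `H`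
(`TorusLineTrigSums`); along a summable subsequence the translation–Tonelli identity makes the line `L¹`-distances tend
to `0` on every `[-M, M]` for a.e. line; `Q_R` is the line derivative of `P_R`; and the one-dimensional closure lemma
(`IntervalDerivL1Closure.exists_primitive_of_tendsto_L1`) gives the primitive, to which `P_{R_k}` converges POINTWISE
along the full sequence — so `G := lim P_{R_k}` (where the limit exists) is one global representative.

References: L. C. Evans, R. F. Gariepy, *Measure Theory and Fine Properties of Functions* (1992), §4.9.2 Thm. 2;
W. P. Ziemer, *Weakly Differentiable Functions* (1989), Thm. 2.1.4. Tagged folklore.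
-/

noncomputable section

open MeasureTheory Set Filter Topology UnitAddTorus Complex intervalIntegral
open scoped ENNReal NNReal Interval

namespace Literature.Analysis.FunctionSpaces

namespace Torus

-- File-local convention: the measure on `ℝ/ℤ` is the Haar PROBABILITY measure, re-activating the named local
-- instances of `HaarTorusBoundedTrigApprox.lean` (definitionally those of `Mathlib.Analysis.Fourier.AddCircleMulti`
-- and of the tree's `PeriodicFormDomain.lean`), so that `volume` on `UnitAddTorus d` is the measure for which Mathlib's
-- `mFourierCoeff`, `mFourierLp`, `mFourierBasis` are stated.
attribute [local instance] HaarTorus.haarCircle_measureSpace HaarTorus.haarCircle_isAddHaarMeasure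
  HaarTorus.haarCircle_isProbabilityMeasure HaarTorus.haarTorus_isProbabilityMeasure
  HaarTorus.haarTorus_isAddLeftInvariant HaarTorus.haarTorus_isAddRightInvariant

variable {d : Type*} [Fintype d] [DecidableEq d]

/-! ### From `L²` classes to functions -/

omit [DecidableEq d] in
/-- On the probability space `T^d`, `∫ ‖u‖ ≤ ‖u‖_{L²}` for an `L²` class. [folklore] -/
theorem lintegral_enorm_le_ofReal_norm (u : Lp ℂ 2 (volume : Measure (UnitAddTorus d))) :
    ∫⁻ t, ‖(u : UnitAddTorus d → ℂ) t‖ₑ ≤ ENNReal.ofReal ‖u‖ := by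
  have h1 : eLpNorm (u : UnitAddTorus d → ℂ) 1 volume ≤ eLpNorm (u : UnitAddTorus d → ℂ) 2 volume :=
    eLpNorm_le_eLpNorm_of_exponent_le (by norm_num) (Lp.aestronglyMeasurable u)
  rw [eLpNorm_one_eq_lintegral_enorm] at h1
  refine h1.trans_eq ?_
  rw [Lp.norm_def, ENNReal.ofReal_toReal (Lp.eLpNorm_ne_top u)]

omit [DecidableEq d] in
/-- The `L¹` distance of representatives is controlled by the `L²` distance of the classes: if `G = u` a.e. and
`P = v` a.e. then `∫ ‖G - P‖ ≤ ‖u - v‖_{L²}`. [folklore] -/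
theorem lintegral_enorm_sub_le_of_ae_eq {u v : Lp ℂ 2 (volume : Measure (UnitAddTorus d))} {G P : UnitAddTorus d → ℂ}
    (hG : (u : UnitAddTorus d → ℂ) =ᵐ[volume] G) (hP : (v : UnitAddTorus d → ℂ) =ᵐ[volume] P) :
    ∫⁻ t, ‖G t - P t‖ₑ ≤ ENNReal.ofReal ‖u - v‖ := by
  refine le_trans (le_of_eq ?_) (lintegral_enorm_le_ofReal_norm (u - v))
  refine lintegral_congr_ae ?_
  filter_upwards [hG, hP, Lp.coeFn_sub u v] with t h1 h2 h3
  rw [h3, Pi.sub_apply, h1, h2]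

omit [DecidableEq d] in
/-- The box truncation of the Fourier series of an `L²` class, as a function: its class is the truncation. [folklore] -/
theorem coeFn_trigTrunc_ae (u : Lp ℂ 2 (volume : Measure (UnitAddTorus d))) (F : Finset (d → ℤ)) :
    ((∑ n ∈ F, mFourierCoeff (u : UnitAddTorus d → ℂ) n • (mFourierLp 2 n : Lp ℂ 2 (volume : Measure (UnitAddTorus d))) :
      Lp ℂ 2 (volume : Measure (UnitAddTorus d))) : UnitAddTorus d → ℂ) =ᵐ[volume]
      fun t => ∑ n ∈ F, mFourierCoeff (u : UnitAddTorus d → ℂ) n * mFourier n t := by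
  obtain ⟨Pc, hPc, hLp⟩ := exists_continuousMap_trigSum F (fun n => mFourierCoeff (u : UnitAddTorus d → ℂ) n)
  rw [← hLp]
  filter_upwards [ContinuousMap.coeFn_toLp (E := ℂ) (p := 2) (𝕜 := ℂ) (μ := (volume : Measure (UnitAddTorus d))) Pc]
    with t ht
  rw [ht, hPc]

/-- A summable sequence of `L¹` distances along lines: for a.e. `t`, pointwise convergence `P_k t → g t`, and on every
line segment the `L¹` distance tends to `0`. Packaging of `ae_tendsto_lintegral_line_zero` for differences. [folklore] -/
theorem ae_line_conv_of_summable (q : d) {g : UnitAddTorus d → ℂ} (hgm : Measurable g) {P : ℕ → UnitAddTorus d → ℂ}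
    (hPm : ∀ k, Measurable (P k)) (hsum : ∑' k, ∫⁻ t, ‖g t - P k t‖ₑ ≠ ⊤) :
    ∀ᵐ t ∂(volume : Measure (UnitAddTorus d)), Tendsto (fun k => P k t) atTop (𝓝 (g t)) ∧ ∀ M : ℕ,
      Tendsto (fun k => ∫⁻ x in Icc (-(M : ℝ)) M, ‖g (t + Pi.single q ((x : ℝ) : UnitAddCircle)) -
        P k (t + Pi.single q ((x : ℝ) : UnitAddCircle))‖ₑ) atTop (𝓝 0) := by
  have hΦ : ∀ k, Measurable fun t => ‖g t - P k t‖ₑ := fun k => (hgm.sub (hPm k)).enorm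
  have h1 := ae_tendsto_lintegral_line_zero q hΦ hsum
  have h2 : ∀ᵐ t ∂(volume : Measure (UnitAddTorus d)), Tendsto (fun k => P k t) atTop (𝓝 (g t)) := by
    filter_upwards [ae_lt_top (Measurable.tsum hΦ) (by rwa [lintegral_tsum fun k => (hΦ k).aemeasurable])] with t ht
    have h := ENNReal.tendsto_atTop_zero_of_tsum_ne_top ht.ne
    rw [tendsto_iff_norm_sub_tendsto_zero]
    have h' : Tendsto (fun k => (‖g t - P k t‖ₑ).toReal) atTop (𝓝 (0 : ℝ≥0∞).toReal) :=
      (ENNReal.tendsto_toReal ENNReal.zero_ne_top).comp h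
    rw [ENNReal.toReal_zero] at h'
    refine h'.congr fun k => ?_
    rw [toReal_enorm, norm_sub_rev]
  filter_upwards [h1, h2] with t ht1 ht2
  exact ⟨ht2, ht1⟩

/-- Local integrability along almost every line of an integrable function. [folklore] -/
theorem ae_lintegral_line_lt_top (q : d) {Φ : UnitAddTorus d → ℝ≥0∞} (hΦ : Measurable Φ) (hfin : ∫⁻ t, Φ t ≠ ⊤) :
    ∀ᵐ t ∂(volume : Measure (UnitAddTorus d)), ∀ M : ℕ,
      ∫⁻ x in Icc (-(M : ℝ)) M, Φ (t + Pi.single q ((x : ℝ) : UnitAddCircle)) < ⊤ := by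
  rw [ae_all_iff]
  intro M
  have hmeas : Measurable fun t : UnitAddTorus d => ∫⁻ x in Icc (-(M : ℝ)) M, Φ (t + Pi.single q ((x : ℝ) : UnitAddCircle)) :=
    Measurable.lintegral_prod_right (f := fun (t : UnitAddTorus d) (x : ℝ) => Φ (t + Pi.single q ((x : ℝ) : UnitAddCircle)))
      (hΦ.comp (continuous_lineMap q).measurable)
  refine ae_lt_top hmeas ?_
  rw [lintegral_lintegral_line_eq q hΦ]
  exact ENNReal.mul_ne_top ENNReal.ofReal_ne_top hfin

/-! ### The line-ACL representative -/

/-- **Spectral `H¹` classes are absolutely continuous on almost every coordinate line.** Let `g : T^d → ℂ` be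
measurable, square integrable, with finite directional spectral energy `∑ₙ n_q² |ĝ(n)|² < ∞` in the coordinate `q`.
Then there are measurable `G = g` a.e. and `H ∈ L²(T^d)` with `Ĥ(n) = 2πi n_q ĝ(n)` such that for a.e. `t ∈ T^d`:
for all real `a, b`, `x ↦ H(t + x𝐞_q)` is integrable on `[a, b]` and
`G(t + b𝐞_q) - G(t + a𝐞_q) = ∫_a^b H(t + x𝐞_q) dx`. [folklore] -/
theorem exists_lineACL_repr (q : d) {g : UnitAddTorus d → ℂ} (hgm : Measurable g) (hg : MemLp g 2 volume)
    (hK : ∑' n : d → ℤ, ENNReal.ofReal ((n q : ℝ) ^ 2) * ‖mFourierCoeff g n‖ₑ ^ 2 ≠ ⊤) :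
    ∃ G H : UnitAddTorus d → ℂ, Measurable G ∧ Measurable H ∧ G =ᵐ[volume] g ∧ MemLp H 2 volume ∧
      (∀ n, mFourierCoeff H n = (2 * Real.pi * Complex.I * (n q)) * mFourierCoeff g n) ∧
      ∀ᵐ t ∂(volume : Measure (UnitAddTorus d)), ∀ a b : ℝ,
        IntervalIntegrable (fun x => H (t + Pi.single q ((x : ℝ) : UnitAddCircle))) volume a b ∧
        G (t + Pi.single q ((b : ℝ) : UnitAddCircle)) - G (t + Pi.single q ((a : ℝ) : UnitAddCircle)) =
          ∫ x in a..b, H (t + Pi.single q ((x : ℝ) : UnitAddCircle)) := by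
  classical
  -- the `L²` class of `g` and its Fourier coefficients
  set f : Lp ℂ 2 (volume : Measure (UnitAddTorus d)) := hg.toLp g with hf
  have hfg : (f : UnitAddTorus d → ℂ) =ᵐ[volume] g := hg.coeFn_toLp
  have hcoef : ∀ n, mFourierCoeff (f : UnitAddTorus d → ℂ) n = mFourierCoeff g n := fun n =>
    integral_congr_ae (hfg.mono fun t ht => by simp only [ht])
  -- the derivative coefficients are square summable
  set c' : (d → ℤ) → ℂ := fun n => (2 * Real.pi * Complex.I * (n q)) * mFourierCoeff g n with hc'
  have hc's : Summable fun n => ‖c' n‖ ^ 2 := by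
    have hr : Summable fun n : d → ℤ => ((n q : ℝ) ^ 2 * ‖mFourierCoeff g n‖ ^ 2).toNNReal := by
      rw [← ENNReal.tsum_coe_ne_top_iff_summable]
      refine ne_of_eq_of_ne (tsum_congr fun n => ?_) hK
      change ENNReal.ofReal ((n q : ℝ) ^ 2 * ‖mFourierCoeff g n‖ ^ 2) = _
      rw [ENNReal.ofReal_mul (sq_nonneg _), ← ofReal_norm, ENNReal.ofReal_pow (norm_nonneg _)]
    have hr' : Summable fun n : d → ℤ => (n q : ℝ) ^ 2 * ‖mFourierCoeff g n‖ ^ 2 := by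
      have h := NNReal.summable_coe.2 hr
      refine h.congr fun n => ?_
      exact Real.coe_toNNReal _ (by positivity)
    have heq : ∀ n, ‖c' n‖ ^ 2 = (4 * Real.pi ^ 2) * ((n q : ℝ) ^ 2 * ‖mFourierCoeff g n‖ ^ 2) := fun n => by
      rw [hc']
      dsimp only
      rw [norm_mul, mul_pow]
      have : ‖(2 * Real.pi * Complex.I * (n q) : ℂ)‖ ^ 2 = 4 * Real.pi ^ 2 * (n q : ℝ) ^ 2 := by
        rw [norm_mul, norm_mul, norm_mul, Complex.norm_I, mul_one, Complex.norm_ofNat, Complex.norm_real,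
          Real.norm_of_nonneg Real.pi_pos.le, Complex.norm_intCast]
        rw [mul_pow, mul_pow, sq_abs]
        ring
      rw [this]
      ring
    simp only [heq]
    exact hr'.mul_left _
  obtain ⟨h, hh⟩ := exists_Lp_mFourierCoeff_eq c' hc's
  -- a measurable representative `H` of the derivative class
  set H : UnitAddTorus d → ℂ := (Lp.aestronglyMeasurable h).mk _ with hHdef
  have hHh : (h : UnitAddTorus d → ℂ) =ᵐ[volume] H := (Lp.aestronglyMeasurable h).ae_eq_mk
  have hHm : Measurable H := (Lp.aestronglyMeasurable h).stronglyMeasurable_mk.measurable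
  have hHcoef : ∀ n, mFourierCoeff H n = c' n := fun n => by
    rw [← hh n]
    exact integral_congr_ae (hHh.mono fun t ht => by simp only [ht])
  -- the box truncations
  set box : ℕ → Finset (d → ℤ) := fun R => Fintype.piFinset fun _ : d => Finset.Icc (-(R : ℤ)) R with hbox
  set P : ℕ → UnitAddTorus d → ℂ := fun R t => ∑ n ∈ box R, mFourierCoeff g n * mFourier n t with hP
  set Q : ℕ → UnitAddTorus d → ℂ := fun R t => ∑ n ∈ box R, c' n * mFourier n t with hQ
  have hPm : ∀ R, Measurable (P R) := fun R => (continuous_trigSum _ _).measurable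
  have hQm : ∀ R, Measurable (Q R) := fun R => (continuous_trigSum _ _).measurable
  -- `L¹` control by the `L²` tails
  have hPdist : ∀ R, ∫⁻ t, ‖g t - P R t‖ₑ ≤ ENNReal.ofReal ‖f - ∑ n ∈ box R,
      mFourierCoeff (f : UnitAddTorus d → ℂ) n • (mFourierLp 2 n : Lp ℂ 2 (volume : Measure (UnitAddTorus d)))‖ := by
    intro R
    refine lintegral_enorm_sub_le_of_ae_eq hfg ((coeFn_trigTrunc_ae f (box R)).trans (Eventually.of_forall fun t => ?_))
    simp only [hP, hcoef]
  have hQdist : ∀ R, ∫⁻ t, ‖H t - Q R t‖ₑ ≤ ENNReal.ofReal ‖h - ∑ n ∈ box R,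
      mFourierCoeff (h : UnitAddTorus d → ℂ) n • (mFourierLp 2 n : Lp ℂ 2 (volume : Measure (UnitAddTorus d)))‖ := by
    intro R
    refine lintegral_enorm_sub_le_of_ae_eq hHh ((coeFn_trigTrunc_ae h (box R)).trans (Eventually.of_forall fun t => ?_))
    simp only [hQ, hh]
  -- a summable subsequence of the tails
  have htend : Tendsto (fun R => ‖f - ∑ n ∈ box R, mFourierCoeff (f : UnitAddTorus d → ℂ) n •
      (mFourierLp 2 n : Lp ℂ 2 (volume : Measure (UnitAddTorus d)))‖ + ‖h - ∑ n ∈ box R,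
        mFourierCoeff (h : UnitAddTorus d → ℂ) n • (mFourierLp 2 n : Lp ℂ 2 (volume : Measure (UnitAddTorus d)))‖)
      atTop (𝓝 0) := by
    have h0 := (tendsto_norm_sub_trigTrunc_box f).add (tendsto_norm_sub_trigTrunc_box h)
    rwa [add_zero] at h0
  have hchoice : ∀ k : ℕ, ∃ R : ℕ, ‖f - ∑ n ∈ box R, mFourierCoeff (f : UnitAddTorus d → ℂ) n •
      (mFourierLp 2 n : Lp ℂ 2 (volume : Measure (UnitAddTorus d)))‖ + ‖h - ∑ n ∈ box R,
        mFourierCoeff (h : UnitAddTorus d → ℂ) n • (mFourierLp 2 n : Lp ℂ 2 (volume : Measure (UnitAddTorus d)))‖ <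
      (1 / 2 : ℝ) ^ k := fun k =>
    (htend.eventually (gt_mem_nhds (by positivity))).exists
  choose Rs hRs using hchoice
  have hgeom : ∑' k : ℕ, ENNReal.ofReal ((1 / 2 : ℝ) ^ k) ≠ ⊤ := by
    rw [← ENNReal.ofReal_tsum_of_nonneg (fun k => by positivity) (summable_geometric_of_lt_one (by norm_num) (by norm_num))]
    exact ENNReal.ofReal_ne_top
  have hsumP : ∑' k, ∫⁻ t, ‖g t - P (Rs k) t‖ₑ ≠ ⊤ := by
    refine ne_top_of_le_ne_top hgeom (ENNReal.tsum_le_tsum fun k => (hPdist (Rs k)).trans (ENNReal.ofReal_le_ofReal ?_))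
    linarith [hRs k, norm_nonneg (h - ∑ n ∈ box (Rs k), mFourierCoeff (h : UnitAddTorus d → ℂ) n •
      (mFourierLp 2 n : Lp ℂ 2 (volume : Measure (UnitAddTorus d))))]
  have hsumQ : ∑' k, ∫⁻ t, ‖H t - Q (Rs k) t‖ₑ ≠ ⊤ := by
    refine ne_top_of_le_ne_top hgeom (ENNReal.tsum_le_tsum fun k => (hQdist (Rs k)).trans (ENNReal.ofReal_le_ofReal ?_))
    linarith [hRs k, norm_nonneg (f - ∑ n ∈ box (Rs k), mFourierCoeff (f : UnitAddTorus d → ℂ) n •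
      (mFourierLp 2 n : Lp ℂ 2 (volume : Measure (UnitAddTorus d))))]
  -- the global representative: the pointwise limit of the truncations where it exists
  set G : UnitAddTorus d → ℂ := fun t => limUnder atTop (fun k => P (Rs k) t) with hGdef
  have hGm : Measurable G :=
    (MeasureTheory.StronglyMeasurable.limUnder (l := atTop) (f := fun k t => P (Rs k) t)
      fun k => (continuous_trigSum _ _).stronglyMeasurable).measurable
  -- almost every line is good
  have hlinesP := ae_line_conv_of_summable q hgm (fun k => hPm (Rs k)) hsumP
  have hlinesQ := ae_line_conv_of_summable q hHm (fun k => hQm (Rs k)) hsumQ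
  have hgL1 : ∫⁻ t, ‖g t‖ₑ ≠ ⊤ := by
    have h1 := lintegral_enorm_le_ofReal_norm f
    have h2 : ∫⁻ t, ‖g t‖ₑ = ∫⁻ t, ‖(f : UnitAddTorus d → ℂ) t‖ₑ := lintegral_congr_ae (hfg.mono fun t ht => by
      dsimp only; rw [ht])
    rw [h2]
    exact ne_top_of_le_ne_top ENNReal.ofReal_ne_top h1
  have hHL1 : ∫⁻ t, ‖H t‖ₑ ≠ ⊤ := by
    have h1 := lintegral_enorm_le_ofReal_norm h
    have h2 : ∫⁻ t, ‖H t‖ₑ = ∫⁻ t, ‖(h : UnitAddTorus d → ℂ) t‖ₑ := lintegral_congr_ae (hHh.mono fun t ht => by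
      dsimp only; rw [ht])
    rw [h2]
    exact ne_top_of_le_ne_top ENNReal.ofReal_ne_top h1
  have hlinesg := ae_lintegral_line_lt_top q hgm.enorm hgL1
  have hlinesH := ae_lintegral_line_lt_top q hHm.enorm hHL1
  refine ⟨G, H, hGm, hHm, ?_, (Lp.memLp h).ae_eq hHh, hHcoef, ?_⟩
  · -- `G = g` a.e.: `P (Rs k) → g` a.e. along the full sequence
    filter_upwards [hlinesP] with t ht
    exact ht.1.limUnder_eq
  filter_upwards [hlinesP, hlinesQ, hlinesg, hlinesH] with t htP htQ htg htH
  -- along the line through `t`: derivatives, continuity, measurability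
  have hderiv : ∀ k x, HasDerivAt (fun y : ℝ => P (Rs k) (t + Pi.single q ((y : ℝ) : UnitAddCircle)))
      (Q (Rs k) (t + Pi.single q ((x : ℝ) : UnitAddCircle))) x := fun k x =>
    hasDerivAt_trigSum_line (box (Rs k)) (fun n => mFourierCoeff g n) q t x
  have hψc : ∀ k, Continuous fun y : ℝ => Q (Rs k) (t + Pi.single q ((y : ℝ) : UnitAddCircle)) := fun k =>
    continuous_trigSum_line (box (Rs k)) c' q t
  have hmeas_line : ∀ (u : UnitAddTorus d → ℂ), Measurable u →
      Measurable fun x : ℝ => u (t + Pi.single q ((x : ℝ) : UnitAddCircle)) :=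
    fun u hu => hu.comp ((continuous_lineMap q).comp (Continuous.prodMk_right t)).measurable
  -- integrability of the line restrictions on `[-M, M]`
  have hint_line : ∀ (u : UnitAddTorus d → ℂ), Measurable u → ∀ M : ℕ,
      ∫⁻ x in Icc (-(M : ℝ)) M, ‖u (t + Pi.single q ((x : ℝ) : UnitAddCircle))‖ₑ < ⊤ →
      IntervalIntegrable (fun x : ℝ => u (t + Pi.single q ((x : ℝ) : UnitAddCircle))) volume (-(M : ℝ)) M := by
    intro u hu M hM
    rw [intervalIntegrable_iff_integrableOn_Icc_of_le (by simp : (-(M : ℝ)) ≤ M)]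
    exact ⟨(hmeas_line u hu).aestronglyMeasurable, hM⟩
  -- the `L¹` convergence along the line segments, in the form needed by the closure lemma
  have hconv_line : ∀ (u : UnitAddTorus d → ℂ), Measurable u → ∀ (V : ℕ → UnitAddTorus d → ℂ), (∀ k, Measurable (V k)) →
      ∀ M : ℕ, Tendsto (fun k => ∫⁻ x in Icc (-(M : ℝ)) M, ‖u (t + Pi.single q ((x : ℝ) : UnitAddCircle)) -
        V k (t + Pi.single q ((x : ℝ) : UnitAddCircle))‖ₑ) atTop (𝓝 0) →
      Tendsto (fun k => ∫ x in (-(M : ℝ))..M, ‖V k (t + Pi.single q ((x : ℝ) : UnitAddCircle)) -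
        u (t + Pi.single q ((x : ℝ) : UnitAddCircle))‖) atTop (𝓝 0) := by
    intro u hu V hV M hM
    have h1 : Tendsto (fun k => (∫⁻ x in Icc (-(M : ℝ)) M, ‖u (t + Pi.single q ((x : ℝ) : UnitAddCircle)) -
        V k (t + Pi.single q ((x : ℝ) : UnitAddCircle))‖ₑ).toReal) atTop (𝓝 (0 : ℝ≥0∞).toReal) :=
      (ENNReal.tendsto_toReal ENNReal.zero_ne_top).comp hM
    rw [ENNReal.toReal_zero] at h1
    refine h1.congr fun k => ?_
    have hm : AEStronglyMeasurable (fun x : ℝ => V k (t + Pi.single q ((x : ℝ) : UnitAddCircle)) -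
        u (t + Pi.single q ((x : ℝ) : UnitAddCircle))) (volume.restrict (Icc (-(M : ℝ)) M)) :=
      ((hmeas_line _ (hV k)).sub (hmeas_line u hu)).aestronglyMeasurable
    have e1 := integral_norm_eq_lintegral_enorm hm
    rw [integral_of_le (by simp : (-(M : ℝ)) ≤ M), restrict_Ioc_eq_restrict_Icc, e1]
    congr 1
    refine lintegral_congr fun x => ?_
    rw [← enorm_neg, neg_sub]
  intro a b
  exact limUnder_sub_limUnder_eq_integral hderiv hψc (fun M => hint_line g hgm M (htg M))
    (fun M => hint_line H hHm M (htH M)) (fun M => hconv_line g hgm (fun k => P (Rs k)) (fun k => hPm (Rs k)) M (htP.2 M))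
    (fun M => hconv_line H hHm (fun k => Q (Rs k)) (fun k => hQm (Rs k)) M (htQ.2 M)) a b

end Torus

end Literature.Analysis.FunctionSpaces

end
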